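import Summits.BirchSwinnertonDyer.Rank1Residual.X2.GreenbergVatsalTorsionCurve
import Literature.NumberTheory.EllipticCurves.SelmerFiniteProofs
import Literature.NumberTheory.EllipticCurves.KodairaNeronUnramifiedInertiaProofs
import Literature.NumberTheory.EllipticCurves.PeriodIndexCorestrictionLocal
import HarnessLib

/-!
# The link `Sel_{p^∞}(E/K_∞) ⊆ S^{Σ₀}_{E[p^∞]}(K_∞)`: the classical Selmer group — whose Pontryagin
# dual is the `D.X` of `SelmerDualData` / route G's `CongruentLambdaShift` — lies inside
# Greenberg–Vatsal's non-primitive Greenberg Selmer group (referee R102.2 (b),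
# nit `gvSelmer-SelmerDualData-link`)

HONEST FRAMING (cell `b2b-bsdres`, run/shared/lean/b2b/bsd-rank1-residual/, verbatim in every
file): the goal of the cell is to DELETE the COMBINATION-SHAPED residual classes of the
Birch–Swinnerton-Dyer formula for ALL analytic-rank `≤ 1` elliptic curves over `ℚ` — "full BSD
formula for every rank `≤ 1` curve in class `C`" assembled STRICTLY from published theorems — so
that the rank-`≤ 1` remainder becomes exactly the CONSTRUCTION-SHAPED classes, which are TYPED
(missing-input `Prop`s), NOT attempted. This is not "finishing BSD". Sub-cell
`b2b-bsdres-eisenstein-p2` (CLASS-OWNERS row "X2"), gen 9: research route; NO CLAIM BEYOND STATED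
CLASSES; nothing here changes a label. Theorems only (no `def`, no named fact, nothing asserted).

THE TWO OBJECTS. (1) `WeierstrassCurve.selmerInfty κ = Sel_{p^∞}(E/K_∞) ⊆ H¹(ker κ, E[p^∞])`
(file `IwasawaSelmer`; `WeierstrassCurve.selmerGroupOver` of `SubgroupSelmer`: the CLASSICAL local
condition "`conj_σ c` dies in `H¹(H_{K_v}, E(K̄_v))`" at EVERY finite place `v` and every `σ ∈ Γ_K`,
plus the archimedean conditions). Its Pontryagin dual `Hom(Sel_{p^∞}(E/K_∞), ℚ/ℤ)` IS — through the
fields `toDual`, `bijective` of the hypothesis structure `WeierstrassCurve.SelmerDualData W κ γ` — the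
`Λ`-module `D.X` whose `lambdaInvariant` enters route G's typed input
`X1.CongruenceTransfer.CongruentLambdaShift` (and `X2.CongruenceTransfer.AlgebraicInvariantsEq`).
(2) `GreenbergVatsalTorsion.gvSelmerInfty κ E[p^∞] L Σ₀ = S^{Σ₀}_{E[p^∞]}(K_∞)` (gen 8): unramified
at the finite `v ∉ Σ₀ ∪ {v ∣ p}`, Greenberg's condition `res ↦ 0 ∈ H¹(H ⊓ I_v, E[p^∞]/M⁺_v)` at
`v ∣ p`, NOTHING at `Σ₀` and at `∞` — the object of the kernel comparison
`#S^{Σ₀}_{E[p^∞][p]} = #S^{Σ₀}_{E[p^∞]}[p] · #E(K_∞)[p^∞][p]` (flag `GV-Prop28-H0-remark`, R98.2 (β)).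
Both are `AddSubgroup`s of the SAME ambient group `subgroupH1 (ker κ) E[p^∞]`.

WHAT THIS FILE PROVES — the INCLUSION half of the identification, for every number field `K`,
every normal `H ≤ Γ_K` (so every `L = K̄^H`, e.g. `K_∞`), every `Σ₀` containing the bad places
prime to `p`, and every Greenberg datum `(M⁺_v)_{v ∣ p}` satisfying the KUMMER COMPATIBILITY
"`σP - P ∈ E[p^∞]` with `σ` in the local inertia group and `P ∈ E(K̄_v)` ⟹ `σP - P ∈ M⁺_v`"
(discharged for Greenberg's own datum `ker(E[p^∞] → Ẽ(k̄_v))` of a good prime of `E/ℚ` in the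
sibling file `GreenbergVatsalReductionDatum`):
* §1–§2 cocycle criteria for `unramKer`, `greenbergKer` and the classical `localKerOver`;
* §3 **`localKerOver_le_unramKer`** — at a GOOD `v ∤ p` the classical condition over `L` implies
  "unramified at the place of `L` above `v`": Silverman's Cor. X.4.4 run over `L` with
  `E[p^∞]`-coefficients, from the tree theorems `smul_localPoints_eq_of_mem_inertia_holds` (the
  reduction step VIII.1.4 = VII.3.1(b)) and `inertia_eq_absInertia` (`I_𝔐 = absInertia K_v`); this is
  Greenberg's "`Im κ_η = 0` for `η ∤ p`" half of `Sel_E(F_∞)_p ⊆ S_A(F_∞)` in the only direction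
  needed for an inclusion;
* §4 **`localKerOver_le_greenbergKer`** — at `v ∣ p` the classical condition implies Greenberg's,
  for a Kummer-compatible datum;
* §5 **`selmerGroupOver_le_gvSelmer`**, **`selmerInfty_le_gvSelmerInfty`** — GV's (6)
  `Sel_E(ℚ_∞)_p ⊆ S_A(ℚ_∞) ⊆ S^{Σ₀}_A(ℚ_∞)` as a containment of `AddSubgroup`s of
  `H¹(ker κ, E[p^∞])`; `exists_eq_toDual_comp_inclusion` — every character of `S^{Σ₀}` restricts to
  a unique element of `D.X` (the dual dictionary, stated on the nose).
WHAT STAYS PRINTED (not re-proved, not asserted): the EQUALITY/corank bookkeeping of the quotient —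
Greenberg LNM 1716 Props. 2.1–2.4 (`Sel_E(ℚ_∞)_p = S_A(ℚ_∞)` at good ordinary `p`), GV pp. 14–15
(`λ(S_A) = λ(Sel) + e_p` at `p ‖ N`), GV Cor. (2.3) + Prop. (2.4) (`S^{Σ₀}_A/S_A ≅ ∏_{ℓ∈Σ₀} 𝓗_ℓ`,
`λ(𝓗_ℓ) = s_ℓ d_ℓ`, `μ = 0`) and Prop. (2.5) (no finite `Λ`-submodule; NO torsion/`H⁰` clause — lit
C119) — exactly the per-pair suppliers of `CongruentLambdaShift` named in its docstring.

References: Greenberg–Vatsal, Invent. Math. 142 (2000) = arXiv:math/9906215, §2 p. 19 (6), pp. 16–17;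
Greenberg, LNM 1716 (1999), §2 pp. 69–75 (Props. 2.1–2.4); Silverman, *AEC* 2nd ed., X.§4
(Cor. 4.4), VIII.1.4, VII.3.1(b); Neukirch, *ANT*, II (9.3), (9.6).
-/

noncomputable section

open scoped Classical AddSubgroup

open NumberField IsDedekindDomain Field
open Literature.NumberTheory.EllipticCurves Literature.NumberTheory.EllipticCurves.GreenbergSelmer
  Literature.NumberTheory.GaloisRepresentations
  Summit.BirchSwinnertonDyer.Rank1Residual.X2.GreenbergVatsalTorsion

universe u

namespace Summit.BirchSwinnertonDyer.Rank1Residual.X2.GreenbergVatsalSelmerLink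

variable {K : Type u} [Field K] [NumberField K]

/-! ## §1. Cocycle criteria for the local conditions of `S^{Σ₀}_M(L)` -/

section Criteria

variable (H : Subgroup (absoluteGaloisGroup K)) (M : Type u) [AddCommGroup M]
  [DistribMulAction (absoluteGaloisGroup K) M] [TopologicalSpace M] [DiscreteTopology M]

/-- **Cocycle criterion for the unramified condition**: the class of a continuous cocycle
`f : H → M` lies in `unramKer H M v` iff `f` is principal on the inertia group `H ⊓ I_v`.
[folklore] -/
theorem oneCocycleClass_mem_unramKer_iff (v : HeightOneSpectrum (𝓞 K))
    (f : contOneCocycles (discreteTopRep H M)) :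
    oneCocycleClass (discreteTopRep H M) f ∈ unramKer H M v ↔
      ∃ m : M, ∀ x : inertiaIn H v, f.1 (inertiaInToH H v x) = x • m - m := by
  rw [unramKer, AddMonoidHom.mem_ker, resH1Hom_oneCocycleClass, oneCocycleClass_eq_zero_iff]
  rfl

/-- A cocycle VANISHING on `H ⊓ I_v` has unramified class. [folklore] -/
theorem oneCocycleClass_mem_unramKer_of_forall_eq_zero (v : HeightOneSpectrum (𝓞 K))
    (f : contOneCocycles (discreteTopRep H M))
    (hf : ∀ x : inertiaIn H v, f.1 (inertiaInToH H v x) = 0) :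
    oneCocycleClass (discreteTopRep H M) f ∈ unramKer H M v :=
  (oneCocycleClass_mem_unramKer_iff H M v f).2 ⟨0, fun x ↦ by rw [smul_zero, sub_zero]; exact hf x⟩

/-- **Cocycle criterion for Greenberg's condition at `v ∣ p`**: the class of `f` lies in
`N.greenbergKer H` iff `f mod M⁺_v` is principal on `H ⊓ I_v` with values in `M/M⁺_v`.
[folklore] -/
theorem oneCocycleClass_mem_greenbergKer_iff {v : HeightOneSpectrum (𝓞 K)} (N : LocalDatum K M v)
    (f : contOneCocycles (discreteTopRep H M)) :
    oneCocycleClass (discreteTopRep H M) f ∈ N.greenbergKer H ↔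
      ∃ q : N.Gr, ∀ x : inertiaIn H v, N.grMk (f.1 (inertiaInToH H v x)) = x • q - q := by
  rw [LocalDatum.mem_greenbergKer_iff, LocalDatum.greenbergMap, resH1Hom_oneCocycleClass,
    oneCocycleClass_eq_zero_iff]
  rfl

/-- A cocycle with values in `M⁺_v` on `H ⊓ I_v` satisfies Greenberg's condition at `v`.
[folklore] -/
theorem oneCocycleClass_mem_greenbergKer_of_forall_mem {v : HeightOneSpectrum (𝓞 K)}
    (N : LocalDatum K M v) (f : contOneCocycles (discreteTopRep H M))
    (hf : ∀ x : inertiaIn H v, f.1 (inertiaInToH H v x) ∈ N.plus) :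
    oneCocycleClass (discreteTopRep H M) f ∈ N.greenbergKer H :=
  (oneCocycleClass_mem_greenbergKer_iff H M N f).2 ⟨0, fun x ↦ by
    rw [smul_zero, sub_zero, ← AddMonoidHom.mem_ker, LocalDatum.ker_grMk]; exact hf x⟩

end Criteria

/-! ## §2. The classical (Kummer) local condition, on cocycles -/

section Kummer

variable (W : WeierstrassCurve K) (p : ℕ) (H : Subgroup (absoluteGaloisGroup K))
  (E : Type u) [Field E] [Algebra K E]

omit [NumberField K] in
/-- **Cocycle criterion for the classical local condition** (`WeierstrassCurve.localKerOver`: the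
class dies in `H¹(H_E, E(K̄_E))`, `H_E = (Γ_E → Γ_K)⁻¹(H)`): the class of `f : H → E[p^∞]` satisfies
it iff there is `P ∈ E(K̄_E)` with `ι_* f(res τ) = τ•P - P` for all `τ ∈ H_E` (Kummer/`WC`-triviality).
[folklore] -/
theorem oneCocycleClass_mem_localKerOver_iff
    (f : contOneCocycles (discreteTopRep H (W.geomPrimaryTorsion p))) :
    oneCocycleClass (discreteTopRep H (W.geomPrimaryTorsion p)) f ∈ W.localKerOver p H E ↔
      ∃ P : localPoints W E, ∀ τ : localSubgroup H E,
        pointsMap W E ((f.1 (resGalSubgroup H E τ) : W.geomPrimaryTorsion p) : W.geomPoints) =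
          (τ : absoluteGaloisGroup E) • P - P := by
  rw [WeierstrassCurve.mem_localKerOver_iff, WeierstrassCurve.localResOver,
    WeierstrassCurve.localResOverOfEmb]
  erw [resH1Hom_oneCocycleClass, oneCocycleClass_eq_zero_iff]
  rfl

end Kummer

/-! ## §3. Away from `p`: the classical condition at a good `v ∤ p` forces "unramified over `L`" -/

section Away

variable (W : WeierstrassCurve K) [W.IsElliptic] (p : ℕ) [Fact p.Prime]
  (H : Subgroup (absoluteGaloisGroup K))

/-- An element of the local inertia group `absInertia K_v` restricting into `H` lies in the local
subgroup `H_{K_v}`. [folklore] -/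
theorem mem_localSubgroup_of_absGaloisRestrict_mem {v : HeightOneSpectrum (𝓞 K)}
    {σ : absoluteGaloisGroup (v.adicCompletion K)}
    (hσ : absGaloisRestrict K (v.adicCompletion K) σ ∈ H) :
    σ ∈ localSubgroup H (v.adicCompletion K) := by
  rw [mem_localSubgroup_iff]
  exact hσ

omit [Fact p.Prime] in
/-- **Silverman's Cor. X.4.4 over `L = K̄^H` with `E[p^∞]`-coefficients.** At a finite place `v` of
GOOD reduction with `v ∤ p`, a class of `H¹(H, E[p^∞])` dying in `H¹(H_{K_v}, E(K̄_v))` (the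
classical local condition of `Sel_{p^∞}(E/L)`, `WeierstrassCurve.localKerOver`) is UNRAMIFIED at the
place of `L` above `v` (dies on `H ⊓ I_v`, `GreenbergVatsalTorsion.unramKer`). Proof as printed
(AEC X.§4): a cocycle `f` of the class has `ι_* f(res τ) = τ•P - P` on `H_{K_v}` for some
`P ∈ E(K̄_v)`; for `x ∈ H ⊓ I_v` pick `σ` in the local inertia group above it (`I_v` is by
definition the image of `absInertia K_v`, which is `I_𝔐`, `inertia_eq_absInertia`); `f(x)` is
`p^k`-torsion, so `p^k (σP - P) = O` and `σP = P` by the reduction step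
(`smul_localPoints_eq_of_mem_inertia_holds`, VIII.1.4 = VII.3.1(b), PROVED in the tree); hence
`f(x) = 0`. [cite: SilvermanAEC2009, Cor. X.4.4 (proof of Thm. X.4.2(b))] -/
theorem localKerOver_le_unramKer {v : HeightOneSpectrum (𝓞 K)} (hv : W.HasGoodReductionAt v)
    (hpv : ((p : ℕ) : 𝓞 K) ∉ v.asIdeal) :
    W.localKerOver p H (v.adicCompletion K) ≤ unramKer H (W.geomPrimaryTorsion p) v := by
  intro c hc
  obtain ⟨f, rfl⟩ := oneCocycleClass_surjective (discreteTopRep H (W.geomPrimaryTorsion p)) c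
  obtain ⟨P, hP⟩ := (oneCocycleClass_mem_localKerOver_iff W p H _ f).1 hc
  refine oneCocycleClass_mem_unramKer_of_forall_eq_zero H _ v f fun x ↦ ?_
  obtain ⟨hxH, hxI⟩ := (mem_inertiaIn_iff H v x.1).1 x.2
  obtain ⟨σ, hσI, hσx⟩ := Subgroup.mem_map.1 hxI
  have hσx' : absGaloisRestrict K (v.adicCompletion K) σ =
      ((x : decomp (K := K) v) : absoluteGaloisGroup K) := hσx
  have hσH : σ ∈ localSubgroup H (v.adicCompletion K) :=
    mem_localSubgroup_of_absGaloisRestrict_mem H (by rw [hσx']; exact hxH)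
  have hres : resGalSubgroup H (v.adicCompletion K) ⟨σ, hσH⟩ = inertiaInToH H v x :=
    Subtype.ext hσx'
  have key := hP ⟨σ, hσH⟩
  rw [hres] at key
  -- `f x` is `p^k`-torsion
  obtain ⟨k, hk⟩ := (AddCommGroup.mem_primaryComponent).1 (f.1 (inertiaInToH H v x)).2
  -- the reduction step, at the local inertia group `I_𝔐 = absInertia K_v`
  obtain ⟨w, hw⟩ := v.exists_spectralValuation
  obtain ⟨𝔐, h𝔐⟩ := v.localPrimesAbove_nonempty
  have hσ𝔐 : σ ∈ 𝔐.inertia (absoluteGaloisGroup (v.adicCompletion K)) := by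
    rw [IsDedekindDomain.HeightOneSpectrum.inertia_eq_absInertia hw h𝔐]; exact hσI
  have hbad : v ∉ W.badPlaces (𝓞 K) := fun h ↦ h hv
  have hn : ((((p ^ k : ℕ) : ℤ)) : 𝓞 K) ∉ v.asIdeal := by
    rw [Int.cast_natCast, Nat.cast_pow]
    exact fun h ↦ hpv (v.isPrime.mem_of_pow_mem _ h)
  have hfix : σ • P = P := by
    refine W.smul_localPoints_eq_of_mem_inertia_holds v hbad hn h𝔐 hσ𝔐 ?_
    rw [← key, ← map_zsmul, natCast_zsmul, hk, map_zero]
  rw [hfix, sub_self] at key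
  have h0 : ((f.1 (inertiaInToH H v x) : W.geomPrimaryTorsion p) : W.geomPoints) = 0 :=
    (injective_iff_map_eq_zero _).1 (pointsMapOfEmb_injective W _) _ key
  exact_mod_cast h0

end Away

/-! ## §4. At `v ∣ p`: the classical condition forces Greenberg's condition, for data satisfying
the Kummer compatibility -/

section AtP

variable (W : WeierstrassCurve K) (p : ℕ) (H : Subgroup (absoluteGaloisGroup K))

/-- **The classical condition implies Greenberg's condition at `v ∣ p`** for a local datum
`N = M⁺_v ≤ E[p^∞]` with the KUMMER COMPATIBILITY: every torsion point of the form `σP - P`,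
`σ ∈ I_{K_v}` (local inertia), `P ∈ E(K̄_v)`, lies in `M⁺_v`. (For Greenberg's datum
`M⁺_v = ker(E[p^∞] → Ẽ(k̄_v))` at a good `v` this holds because inertia acts trivially on the
reduction; for the Tate-curve datum at a multiplicative `v` because `σ(u)/u` is a principal unit.)
Then every class dying in `H¹(H_{K_v}, E(K̄_v))` dies in `H¹(H ⊓ I_v, E[p^∞]/M⁺_v)`.
[cite: GreenbergLNM1716, §2 pp. 69–70 (Sel_E ⊆ S_A)] -/
theorem localKerOver_le_greenbergKer {v : HeightOneSpectrum (𝓞 K)}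
    (N : LocalDatum K (W.geomPrimaryTorsion p) v)
    (hN : ∀ σ ∈ absInertia (v.adicCompletion K), ∀ (P : localPoints W (v.adicCompletion K))
      (m : W.geomPrimaryTorsion p),
      pointsMap W (v.adicCompletion K) (m : W.geomPoints) = σ • P - P → m ∈ N.plus) :
    W.localKerOver p H (v.adicCompletion K) ≤ N.greenbergKer H := by
  intro c hc
  obtain ⟨f, rfl⟩ := oneCocycleClass_surjective (discreteTopRep H (W.geomPrimaryTorsion p)) c
  obtain ⟨P, hP⟩ := (oneCocycleClass_mem_localKerOver_iff W p H _ f).1 hc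
  refine oneCocycleClass_mem_greenbergKer_of_forall_mem H _ N f fun x ↦ ?_
  obtain ⟨hxH, hxI⟩ := (mem_inertiaIn_iff H v x.1).1 x.2
  obtain ⟨σ, hσI, hσx⟩ := Subgroup.mem_map.1 hxI
  have hσx' : absGaloisRestrict K (v.adicCompletion K) σ =
      ((x : decomp (K := K) v) : absoluteGaloisGroup K) := hσx
  have hσH : σ ∈ localSubgroup H (v.adicCompletion K) :=
    mem_localSubgroup_of_absGaloisRestrict_mem H (by rw [hσx']; exact hxH)
  have hres : resGalSubgroup H (v.adicCompletion K) ⟨σ, hσH⟩ = inertiaInToH H v x :=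
    Subtype.ext hσx'
  have key := hP ⟨σ, hσH⟩
  rw [hres] at key
  exact hN σ hσI P _ key

end AtP

/-! ## §5. The link: `Sel_{p^∞}(E/L) ≤ S^{Σ₀}_{E[p^∞]}(L)` and `Sel_{p^∞}(E/K_∞) ≤ S^{Σ₀}_{E[p^∞]}(K_∞)` -/

section Link

variable (W : WeierstrassCurve K) [W.IsElliptic] (p : ℕ) [Fact p.Prime]
  (H : Subgroup (absoluteGaloisGroup K)) [H.Normal]
  (L : Data K (W.geomPrimaryTorsion p) p) (S₀ : Set (HeightOneSpectrum (𝓞 K)))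

omit [Fact p.Prime] in
/-- **`Sel_{p^∞}(E/L) ⊆ S^{Σ₀}_{E[p^∞]}(L)`** — the classical Selmer group of the tree
(`WeierstrassCurve.selmerGroupOver`: Kummer conditions at ALL places of `L = K̄^H`) is contained in
Greenberg–Vatsal's non-primitive Greenberg Selmer group (`GreenbergVatsalTorsion.gvSelmer`) for
every set `Σ₀` containing the bad places prime to `p` (`hS`) and every Greenberg datum satisfying
the Kummer compatibility at the places above `p` (`hL`). This is GV's (6)
`Sel_E(ℚ_∞)_p ⊆ S^{Σ₀}_A(ℚ_∞)` composed of Greenberg's `Sel_E(F_∞)_p ⊆ S_A(F_∞)` (LNM 1716 §2: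
`Im κ_η = 0` at `η ∤ p`, `Im κ_η ⊆` Greenberg's condition at `η ∣ p`) and the enlargement at `Σ₀`.
[cite: GreenbergVatsal2000, §2 p. 19, (6)] [cite: GreenbergLNM1716, §2 pp. 69–70] -/
theorem selmerGroupOver_le_gvSelmer
    (hS : ∀ v : HeightOneSpectrum (𝓞 K), v ∉ S₀ → ((p : ℕ) : 𝓞 K) ∉ v.asIdeal →
      W.HasGoodReductionAt v)
    (hL : ∀ (v : HeightOneSpectrum (𝓞 K)) (hv : ((p : ℕ) : 𝓞 K) ∈ v.asIdeal),
      ∀ σ ∈ absInertia (v.adicCompletion K), ∀ (P : localPoints W (v.adicCompletion K))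
        (m : W.geomPrimaryTorsion p),
        pointsMap W (v.adicCompletion K) (m : W.geomPoints) = σ • P - P → m ∈ (L v hv).plus) :
    W.selmerGroupOver p H ≤ gvSelmer H (W.geomPrimaryTorsion p) p L S₀ := by
  intro c hc
  rw [WeierstrassCurve.mem_selmerGroupOver_iff] at hc
  rw [mem_gvSelmer_iff]
  exact ⟨fun v hv hpv σ ↦ localKerOver_le_unramKer W p H (hS v hv hpv) hpv (hc.1 v σ),
    fun v hv σ ↦ localKerOver_le_greenbergKer W p H (L v hv) (hL v hv) (hc.1 v σ)⟩

/-- **`Sel_{p^∞}(E/K_∞) ⊆ S^{Σ₀}_{E[p^∞]}(K_∞)`** over the top of a `ℤ_p`-extension `κ`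
(`H = ker κ`): the object `WeierstrassCurve.selmerInfty κ` of `IwasawaSelmer` — whose Pontryagin
dual `Hom(Sel_{p^∞}(E/K_∞), ℚ/ℤ)` IS, by the fields `toDual`/`bijective` of the hypothesis structure
`WeierstrassCurve.SelmerDualData`, the `Λ`-module `D.X` of every dual datum `D` (the `D.X` of
route G's typed input `X1.CongruenceTransfer.CongruentLambdaShift`) — sits inside the
`gvSelmerInfty` of `GreenbergVatsalTorsion` (the object of the kernel comparison theorems
`natCard_gvSelmer_torsion*`, referee R102.2 (b) `gvSelmer-SelmerDualData-link`).
[cite: GreenbergVatsal2000, §2 p. 19, (6)] [cite: GreenbergLNM1716, §2 pp. 69–70] -/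
theorem selmerInfty_le_gvSelmerInfty (κ : ZpExtension K p)
    (hS : ∀ v : HeightOneSpectrum (𝓞 K), v ∉ S₀ → ((p : ℕ) : 𝓞 K) ∉ v.asIdeal →
      W.HasGoodReductionAt v)
    (hL : ∀ (v : HeightOneSpectrum (𝓞 K)) (hv : ((p : ℕ) : 𝓞 K) ∈ v.asIdeal),
      ∀ σ ∈ absInertia (v.adicCompletion K), ∀ (P : localPoints W (v.adicCompletion K))
        (m : W.geomPrimaryTorsion p),
        pointsMap W (v.adicCompletion K) (m : W.geomPoints) = σ • P - P → m ∈ (L v hv).plus) :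
    W.selmerInfty κ ≤ gvSelmerInfty κ (W.geomPrimaryTorsion p) L S₀ :=
  fun _ hc ↦ selmerGroupOver_le_gvSelmer W p κ.kerSubgroup L S₀ hS hL hc

/-- **The dual dictionary, stated**: for a dual datum `D` (route G's `D.X`), every `x : D.X` IS a
character of `Sel_{p^∞}(E/K_∞)` (`D.toDual x`, bijectively), and `Sel_{p^∞}(E/K_∞)` embeds in
`S^{Σ₀}_{E[p^∞]}(K_∞)` by `AddSubgroup.inclusion`; so characters of `S^{Σ₀}` restrict to elements
of `D.X`. [cite: GreenbergVatsal2000, §2 p. 19, (6)] -/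
theorem exists_eq_toDual_comp_inclusion (κ : ZpExtension K p) (γ : absoluteGaloisGroup K)
    (D : W.SelmerDualData κ γ)
    (hS : ∀ v : HeightOneSpectrum (𝓞 K), v ∉ S₀ → ((p : ℕ) : 𝓞 K) ∉ v.asIdeal →
      W.HasGoodReductionAt v)
    (hL : ∀ (v : HeightOneSpectrum (𝓞 K)) (hv : ((p : ℕ) : 𝓞 K) ∈ v.asIdeal),
      ∀ σ ∈ absInertia (v.adicCompletion K), ∀ (P : localPoints W (v.adicCompletion K))
        (m : W.geomPrimaryTorsion p),
        pointsMap W (v.adicCompletion K) (m : W.geomPoints) = σ • P - P → m ∈ (L v hv).plus)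
    (χ : gvSelmerInfty κ (W.geomPrimaryTorsion p) L S₀ →+ AddCircle (1 : ℚ)) :
    ∃! x : D.X, D.toDual x =
      χ.comp (AddSubgroup.inclusion (selmerInfty_le_gvSelmerInfty W p L S₀ κ hS hL)) :=
  (D.bijective.existsUnique _)

end Link

end Summit.BirchSwinnertonDyer.Rank1Residual.X2.GreenbergVatsalSelmerLink

end
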